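import Mathlib
import Literature.AlgebraicGeometry.CossartPiltant200819.Thm15FrameSHE2019
import Summits.ResolutionOfSingularities.ResolutionOfSingularities.Theorems.RadicialJungCleanModelsCleanLU3DimThreeCentre
import Summits.ResolutionOfSingularities.ResolutionOfSingularities.Theorems.FrobeniusClosingSteerRadicandSingularCriterion
import Summits.ResolutionOfSingularities.ResolutionOfSingularities.Theorems.CleanModels.Negative.CossartPiltant2019Thm15iFrameFalse
import Literature.AlgebraicGeometry.Resolution.TranscendenceDefect
import HarnessLib

/-!
# Crux `DescentPerfectToAll` (stmt-ResolutionOfSingularities-0549) — lens 5 «transfer from the solved sibling», g6: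
# the BASE-SIDE reading of Cossart–Piltant 2019, Thm 1.5 (i), and its `p = 2` tooth for `stub_cleanLU3Defect`
# (rev 1.6: and for the rev-22 residue `stub_cleanLU3DefectNonDiscrete`, with the odd-`p` residual typed;
# rev 1.7: §3d exit tests for that residual — `AffineChartCriterion`, `AffineChartWitness`, `affineChart_cleanLUConcl` ✓, `KRatSandwichAt`)

CENSUS workfile (res-B-lens-5 g6, 2026-08-28/29).  OURS · CANDIDATE · counted 0.  Nothing here proves resolution in
characteristic `p`; no crux, stub or named fact is proved here; Hironaka 2017 is not used.  Customer: the line lead of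
crux stmt-15917 `RadicialJung.CleanModels`, skeleton `Cruxes/CleanModels/Lines/Sketch.lean` rev 17, whose research residue is
the registered stub `stub_cleanLU3Defect` (clean local uniformization at 3-dimensional centres for valuations at which the
`K^p`-line of `g₀` is IMMEDIATE), and the slot `via_clean_models` of this crux (0549 ⟸ CleanModels, ✓ G1′).

## What print gives (page-verified on the held text `paper:cossart2019-resolution-singularities-arithmetical-threefolds`,
## J. Algebra 529 (2019) 268–535; `pNNNN` = PDF page, journal page in brackets)

* Thm 1.5 (p0004–p0005 [271–272]): `S` excellent regular local, `dim S = 3`, residue characteristic `p`; `h = X^p + f₁X^{p-1}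
  + ⋯ + f_p` reduced; case (i) `char K = p`, `f₁ = ⋯ = f_{p-1} = 0`; `μ` a valuation of `L` centred in `m_S` ⟹ a composition of
  LOCAL HIRONAKA-PERMISSIBLE blowing ups `(𝒳₀,x₀) ← ⋯ ← (𝒳_r,x_r)`, `x_i` = centre of `μ`, `(𝒳_r,x_r)` regular.
* Cor 5.6 (p0138 [405]): «Theorem 1.5 is then an immediate consequence of [31] Main Theorem 1.3 (`m(x) < p`), Theorem 2.81
  (`(m(x), ω(x)) = (p, 0)`) and Theorem 5.5», after Cor 4.19 (condition (E)).  [31] = Cossart–Piltant, RACSAM 108 (2014)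
  113–151 («case of small multiplicity»).  p0006 [273]: «The main issue for proving Theorem 1.5 is to achieve `m(x_{r₁}) < p`
  for some `r₁ ≥ 0`; achieving `(𝒳_r,x_r)` regular, i.e. `m(x_r) = 1`, is then relatively easy and has been proved in [31].»
* THE PHASE `m = p` IS BASE-SIDE.  Prop 2.22 (p0027 [294], setting (2.1) p0014 [281]: `h` monic of degree `m = m(x)`):
  a Hironaka-permissible blowing up w.r.t. `E` at `x` sits in a square (2.17) over the blowing up `σ : 𝒮′ → Spec S` along
  `W = η(𝒴)`, `I(𝒴) = (Z, {u_j}_{j∈J})`, the point at infinity is not on `𝒳′`, and `𝒳′_{s′} = Spec S′[X′]/(h′)` with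
  `h′ = u_{j₀}^{-m} h(Z)` (2.18) — for `h = X^p - g`: `h′ = X′^p - (g - θ^p)/u^p`, new radicand `c^p g + d^p`, `c = 1/u ≠ 0`.
  Every blowing up of CP's `m = p` phase is of this form: Lemma 4.14 / Cor 4.19 (p0131–p0135 [398–402]) are stated AS
  compositions «(2.17) w.r.t. `E = ∅`» (diagram (4.19)); Thm 2.81 (p0074 [341]) produces «a Hironaka-permissible center
  `𝒴 ⊂ (𝒳,x)` w.r.t. `E`»; the sequences (5.3) of Thm 5.5 carry «projections `η_i : (𝒳_i,x_i) → Spec S_i`» and «all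
  permissibility conditions (Definitions 2.20, 3.1 and 3.5) always refer to the reduced total transform `E_i` of `E` in `S_i`»
  (p0137 [404] l. 24–35); Prop 2.10 (p0021 [288]): at a point of multiplicity `m = deg h`, `η⁻¹(m_S) = {x}`, `k(x) = S/m_S`.
* THE PHASE `m < p` ([31]) IS NOT BASE-SIDE in general — this is exactly the over-read that killed F-110
  (`CossartPiltant2019_thm_1_5_i_frame`, refuted ✓p676727, witness `p = 5`, `f = x²y`, `m = 3 < p` from the start): at a point
  of multiplicity `m < p = deg_X h` a permissible blow-up divides `h` by the `m`-th (not the `p`-th) power of the exceptional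
  parameter, so the transform is no longer monic in `X`.  [31] is HELD (`paper:doi-10-1007-s13398-012-0103-5`, HAL 2012 = RACSAM
  108 (2014)); its Main Theorem 0.3 (p0002) works in the regular FOURFOLD `R ⊇ X` with Hironaka-permissible centres, and p0004
  l.13–14 reads verbatim: «Since it is assumed that m(x) < p, (X, x) is already regular if p = 2, so we assume p ⩾ 3 from now
  on.» — the `[31]`-phase is EMPTY at `p = 2`.
* Thm 2.81 reads `(m, ω) = (p, 0)` ⟹ reach `m(x_r) < p` by finitely many independent combinatorial blow-ups; it is NOT an
  equivalence «`(p,0)` under (E) ⟺ loosely clean» (answer to the lead's NOTES-g1 «critic hour» question: not in print).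
* Dictionary to the typed tower: `L = K[X]/(X^p - f)` is purely inseparable over `K`, so a valuation ring `O` of `K` has a
  UNIQUE extension `μ` to `L` and CP's `x_i` (centre of `μ`) lies over the centre `s_i` of `O` on `𝒮_i`; `B_i = O_{𝒮_i,s_i}`,
  `g_i` = the current radicand (`h_i = X_i^p - g_i ∈ S_i[X_i]`), `B_i[X]/(X^p - g_i)` is local (finite over `B_i`, one point
  over `s_i`), so «`(𝒳_r,x_r)` regular» is `IsRegularLocalRing (AdjoinRoot (X^p - C g_n))` and «`m(x_i) < p`» is
  `∀ c, g_i - c^p ∉ 𝔪^p` (`m(x) = min (p, ord_𝔪 (g - c^p))` for any `c` with `c̄^p = ḡ`, `= 1` if `ḡ ∉ κ(s)^p`).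
* CORNER (flagged, then mostly discharged from print): the typed statements quantify over ALL valuation rings `O ⊇ S`,
  and so does Thm 1.5 — p0005 [272] l.6 verbatim «Let μ be a valuation of L which is centered in m_S» (no residual
  algebraicity; CP's own (LU) p0118 [385] restricts to `k_v | k` algebraic only in the REDUCTION of Thm 1.1 to Thm 1.5,
  Prop 4.6 / 4.10).  For a residually transcendental `O` the centres `s_i` become non-closed (`dim B_i ≤ 2`) mid-sequence;
  base-sideness of those steps rests on (a) p0005 l.12–13 «We develop an approach … in any dimension n := dim S ≥ 1» (setting
  (2.1) and Prop 2.22 are stated for every `n`), and (b) the E-free core of Prop 2.22's proof: a Hironaka-permissible centre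
  `𝒴 ∋ x` with `x ∈ Sing_m`, `m = deg h`, has `I(𝒴) = (Z, {u_j}_{j∈J})` by Prop 2.10, whence the square (2.17).  What remains a
  READING (not a quoted sentence) is only that CP's blow-ups while `m(x_i) = p` are taken at points of `Sing_p` — which is what
  «Hironaka-permissible» (normal flatness) forces.

## What this file types (kernel-checked compositions; the two literature-shaped `Prop`s are HYPOTHESES, never facts here)

* `CpThm15iFrameAt p` — the body of F-110 at ONE prime `p` (so `CossartPiltant2019_thm_1_5_i_frame ↔ ∀ p, p.Prime →
  CpThm15iFrameAt p`, `frame_iff`, `rfl`); `not_forall_frameAt` (= ✓p676727).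
* `CpBaseSidePhaseAt p` — the SAME tower with the printed end-state of the `m = p` phase: «`m(x_n) < p`», typed
  `∀ c, g n - c^p ∉ 𝔪^p` (multiplicity of `B[X]/(X^p - g)` at its point over the closed point is `min (p, ord_𝔪 (g - c^p))`
  for any `c` with the right residue, and `1` if `ḡ ∉ κ^p`).  This is what Cor 5.6's proof gives for EVERY `p`
  (reading above); `baseSidePhaseAt_of_frameAt`: it is weaker than the frame.
* `p = 2`: `m < 2` is `m = 1` is REGULAR, so the phase `m < p` is empty and `frameAt_two_iff_baseSidePhaseAt_two :
  CpThm15iFrameAt 2 ↔ CpBaseSidePhaseAt 2` (tree ✓ `isRegularLocalRing_adjoinRoot_iff`).  Consequently F-110 AT `p = 2` is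
  the printed theorem read base-side, and (`cleanLU3DefectAt_two_of_frameAt_two`) the `p = 2` instance of the research
  residue `stub_cleanLU3Defect` follows from it — IMMEDIATE valuations included, over every field of characteristic 2.
* `p ≥ 3`: `cleanLU3At_of_baseSidePhaseAt_of_lowMultToCleanAt` — clean LU at 3-dimensional centres (`CleanLU3At p`, the
  shape of `stub_cleanLU3Defect` without its immediacy hypothesis) follows from the printed phase `CpBaseSidePhaseAt p` AND the
  residual `LowMultToCleanAt p` («a representative of the line of multiplicity `< p` at a regular centre can be cleaned along
  the valuation by a finitely generated enlargement»).  The residual is a genuine special case of the clean-LU problem (it is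
  NOT formal: the point blow-up of `Z^p - F`, `2 ≤ ord F ≤ p - 1`, has exceptional exponent `ord F ≢ 0 (mod p)` — clean off the
  strict transform — but later exponents can be `≡ 0`; immediate valuations are where it bites).  `lowMultToCleanAt_two`:
  at `p = 2` the residual is trivially true.

REV 1.6 (g8, 2026-08-29; Sketch rev 22 currency, companion memo `T44iii-anchor-perprime-lens5-g8.md`): §3c types the lead's
registered residue `stub_cleanLU3DefectNonDiscrete` (classes (B)/(C): zero-dimensional, NOT discrete of rank one) at ONE prime —
`CleanLU3DefectNonDiscreteAt p`, verbatim (`cleanLU3DefectNonDiscreteAt_iff_rev22`, `Iff.rfl`) — and the PER-PRIME CUT of it: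
`cleanLU3DefectNonDiscreteAt_two_of_frameAt_two : CpThm15iFrameAt 2 → CleanLU3DefectNonDiscreteAt 2` (p = 2 is a printed corollary
mod F-112: the [31]-phase is empty, every blow-up of CP's proof sits in Prop 2.22's square), and for odd `p`
`cleanLU3DefectNonDiscreteAt_of_baseSidePhaseAt_of_lowMult : CpBaseSidePhaseAt p → LowMultToCleanNonDiscreteAt p →
CleanLU3DefectNonDiscreteAt p`, where `LowMultToCleanNonDiscreteAt p` («multiplicity `< p` at a regular centre ⟹ loosely clean
along a zero-dimensional NON-DISCRETE `O` with no best approximation», the rev-22 hypotheses verbatim) is the ONE unprinted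
residual — RESEARCH, expected true, not a corollary of Thm 1.5(i) + Prop 2.22 at odd `p` (Cor 5.6: points with `1 < m < p` go to
[31] in the regular fourfold, outside the square; critic TRIAGE-44 §(iii)'s anchor is corrected to p = 2 by the memo).  The g6
composition is refactored through `exists_lowMultModel_of_baseSidePhaseAt` (the printed phase delivers a finitely generated
regular model carrying a representative of multiplicity `< p`); statements of rev ≤ 1.5a are unchanged.

RECOMMENDATIONS to the lead (memo `STUBPLAN-cleanLU3Defect-cpBaseSide-lens5.md`): (R1) re-parametrise the vacuous
✓ `cleanLU_of_frame_of_dimThreeCentre` to the per-prime hypothesis `CpThm15iFrameAt p` (its proof uses `hF` at the one prime);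
(R2) cut `stub_cleanLU3Defect` into `p = 2` (⟸ per-prime frame at 2, a PRINTED input to be typed by INPUTS with the erratum's
diagnosis corrected: the over-read step is the `[31]`-phase, empty at `p = 2`) and `p` odd (research, = `LowMultToCleanAt p`
for immediate valuations after the printed phase).  [cite: CossartPiltant2019, Thm. 1.5 (i), Prop. 2.10, Prop. 2.22,
Lemma 4.14, Cor. 4.19, Thm. 2.81, Thm. 5.5, Cor. 5.6]
-/

noncomputable section

set_option linter.dupNamespace false

open IsLocalRing Polynomial
open Literature.AlgebraicGeometry.Resolution
open Literature.AlgebraicGeometry.CossartPiltant200819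
open Summit.ResolutionOfSingularities.ResolutionOfSingularities.Theorems
open Summit.ResolutionOfSingularities.ResolutionOfSingularities.Theorems.RadicialJung.CleanModels
open Summit.ResolutionOfSingularities.ResolutionOfSingularities.Theorems.SwitchingDichotomy.RadicandSingular
open Summit.ResolutionOfSingularities.ResolutionOfSingularities.Theorems.CleanModels.Negative

namespace Summit.ResolutionOfSingularities.ResolutionOfSingularities.Cruxes.DescentPerfectToAll.CpSibling.BaseSide

universe u

/-! ## §1 The frame at one prime -/

/-- **F-110 at ONE prime `p`**: verbatim the body of `Literature.AlgebraicGeometry.CossartPiltant200819.CossartPiltant2019_thm_1_5_i_frame`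
with its leading binder `∀ (p : ℕ), p.Prime →` removed.  At `p ≥ 3` it inherits F-110's over-read (end clause «regular»
after a base-side tower); at `p = 2` it is the printed theorem read base-side (`frameAt_two_iff_baseSidePhaseAt_two` and the
module docstring).  A HYPOTHESIS shape, not a fact. [cite: CossartPiltant2019, Thm. 1.5 (i), Prop. 2.22, Cor. 5.6] -/
def CpThm15iFrameAt (p : ℕ) : Prop :=
    ∀ (S : Type u) [CommRing S] [IsRegularLocalRing S],
      IsExcellentRing S → ringKrullDim S = 3 → CharP S p →
    ∀ (K : Type u) [Field K] [Algebra S K] [IsFractionRing S K] (f : S),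
      (∀ c : K, c ^ p ≠ algebraMap S K f) →
    ∀ (O : ValuationSubring K), (algebraMap S K).range ≤ O.toSubring →
      (∀ s ∈ IsLocalRing.maximalIdeal S, O.valuation (algebraMap S K s) < 1) →
    ∃ (n : ℕ) (B : ℕ → Subring K) (g : ℕ → K),
      B 0 = locAtCentre (algebraMap S K).range O ∧ g 0 = algebraMap S K f ∧
      (∀ i ≤ n, B i ≤ O.toSubring ∧ IsRegularLocalRing (B i) ∧ g i ∈ B i) ∧
      (∀ i < n, ∃ P : Ideal (B i), IsRegularLocalRing ((B i) ⧸ P) ∧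
        IsLocalBlowupAlong O (B i) P (B (i + 1)) ∧
        ∃ c d : K, c ≠ 0 ∧ g (i + 1) = c ^ p * g i + d ^ p) ∧
      ∀ hg : g n ∈ B n, IsRegularLocalRing (AdjoinRoot (Polynomial.X ^ p - Polynomial.C (⟨g n, hg⟩ : B n)))

/-- F-110 is the conjunction of its per-prime instances (definitional). [folklore] -/
theorem frame_iff : CossartPiltant2019_thm_1_5_i_frame.{u} ↔ ∀ p : ℕ, p.Prime → CpThm15iFrameAt.{u} p := Iff.rfl

/-- The per-prime family as a whole is refuted (tree ✓p676727, witness `p = 5`); NO instance at `p = 2` is refuted by it.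
[folklore] -/
theorem not_forall_frameAt : ¬ ∀ p : ℕ, p.Prime → CpThm15iFrameAt.{0} p :=
  fun h => CossartPiltant2019_thm_1_5_i_frame_false (frame_iff.mpr h)

/-! ## §2 The printed `m = p` phase: the same tower, ending at multiplicity `< p` -/

/-- **The base-side phase of Cossart–Piltant 2019, Thm 1.5 (i)** (reading of Cor 5.6's proof: Cor 4.19 + Thm 2.81 + Thm 5.5,
every blowing up of the form (2.17)/(2.18) by Prop 2.22): the tower of F-110 with the END clause replaced by the printed
end-state of that phase, «the multiplicity of `B_n[X]/(X^p - g_n)` at its point over the closed point is `< p`», typed as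
`∀ c, g_n - c^p ∉ 𝔪^p`.  A HYPOTHESIS shape (to be typed by INPUTS if wanted), not a fact.
[cite: CossartPiltant2019, Prop. 2.10, Prop. 2.22, Lemma 4.14, Cor. 4.19, Thm. 2.81, Thm. 5.5, Cor. 5.6] -/
def CpBaseSidePhaseAt (p : ℕ) : Prop :=
    ∀ (S : Type u) [CommRing S] [IsRegularLocalRing S],
      IsExcellentRing S → ringKrullDim S = 3 → CharP S p →
    ∀ (K : Type u) [Field K] [Algebra S K] [IsFractionRing S K] (f : S),
      (∀ c : K, c ^ p ≠ algebraMap S K f) →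
    ∀ (O : ValuationSubring K), (algebraMap S K).range ≤ O.toSubring →
      (∀ s ∈ IsLocalRing.maximalIdeal S, O.valuation (algebraMap S K s) < 1) →
    ∃ (n : ℕ) (B : ℕ → Subring K) (g : ℕ → K),
      B 0 = locAtCentre (algebraMap S K).range O ∧ g 0 = algebraMap S K f ∧
      (∀ i ≤ n, B i ≤ O.toSubring ∧ IsRegularLocalRing (B i) ∧ g i ∈ B i) ∧
      (∀ i < n, ∃ P : Ideal (B i), IsRegularLocalRing ((B i) ⧸ P) ∧
        IsLocalBlowupAlong O (B i) P (B (i + 1)) ∧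
        ∃ c d : K, c ≠ 0 ∧ g (i + 1) = c ^ p * g i + d ^ p) ∧
      ∀ (hg : g n ∈ B n) (_hBn : IsRegularLocalRing (B n)) (c : B n),
        (⟨g n, hg⟩ : B n) - c ^ p ∉ IsLocalRing.maximalIdeal (B n) ^ p

/-- The frame implies the printed phase (regular end ⟹ `∀ c, g_n - c^p ∉ 𝔪² ⊇ 𝔪^p`, tree ✓ `isRegularLocalRing_adjoinRoot_iff`):
the phase is the WEAKER statement. [folklore] -/
theorem baseSidePhaseAt_of_frameAt (p : ℕ) (hp : p.Prime) (hF : CpThm15iFrameAt.{u} p) : CpBaseSidePhaseAt.{u} p := by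
  intro S _ _ hexc hdim hchar K _ _ _ f hf O hO hdom
  obtain ⟨n, B, g, h0, hg0, hall, hstep, hend⟩ := hF S hexc hdim hchar K f hf O hO hdom
  refine ⟨n, B, g, h0, hg0, hall, hstep, fun hg hBn c hc => ?_⟩
  haveI : Fact p.Prime := ⟨hp⟩
  haveI : IsRegularLocalRing (B n) := hBn
  haveI : CharP K p := charP_of_injective_algebraMap (IsFractionRing.injective S K) p
  haveI : CharP (B n) p := ((B n).subtype).charP Subtype.val_injective p
  exact (isRegularLocalRing_adjoinRoot_iff p (⟨g n, hg⟩ : B n)).mp (hend hg) c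
    (Ideal.pow_le_pow_right hp.two_le hc)

/-- **`p = 2`: the printed phase IS the frame** (`m < 2` means regular; tree ✓ `isRegularLocalRing_adjoinRoot_iff` at `p = 2`
reads `B_n[X]/(X² - g_n)` regular ⟺ `∀ c, g_n - c² ∉ 𝔪²`).  So F-110 at `p = 2` carries no over-read beyond the base-side
reading of the `m = p` phase. [folklore] -/
theorem frameAt_two_iff_baseSidePhaseAt_two : CpThm15iFrameAt.{u} 2 ↔ CpBaseSidePhaseAt.{u} 2 := by
  refine ⟨baseSidePhaseAt_of_frameAt 2 Nat.prime_two, fun h => ?_⟩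
  intro S _ _ hexc hdim hchar K _ _ _ f hf O hO hdom
  obtain ⟨n, B, g, h0, hg0, hall, hstep, hend⟩ := h S hexc hdim hchar K f hf O hO hdom
  refine ⟨n, B, g, h0, hg0, hall, hstep, fun hg => ?_⟩
  haveI : Fact (2 : ℕ).Prime := ⟨Nat.prime_two⟩
  haveI hBn : IsRegularLocalRing (B n) := (hall n le_rfl).2.1
  haveI : CharP K 2 := charP_of_injective_algebraMap (IsFractionRing.injective S K) 2
  haveI : CharP (B n) 2 := ((B n).subtype).charP Subtype.val_injective 2
  exact (isRegularLocalRing_adjoinRoot_iff 2 (⟨g n, hg⟩ : B n)).mpr (hend hg hBn)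

/-! ## §3 The clean-LU currency of the customer (`stub_cleanLU3Defect`, Sketch rev 17) -/

section Customer

/-- The CONCLUSION of `stub_cleanLU3` / `stub_cleanLU3Defect` / ✓ `cleanLU_of_frame_of_dimThreeCentre` (verbatim): a finitely
generated `A ⊆ A' ⊆ O`, regular at the centre of `O`, carrying there a loosely clean non-trivial representative of the
`K^p`-line of `g₀`. [folklore] -/
def CleanLUConcl (p : ℕ) (k K : Type) [Field k] [Field K] [Algebra k K] (O : ValuationSubring K) (A : Subalgebra k K)
    (g₀ : K) : Prop :=
    ∃ (A' : Subalgebra k K), A'.toSubring ≤ O.toSubring ∧ A ≤ A' ∧ A'.FG ∧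
      ∃ (_ : IsRegularLocalRing (locAtCentre A'.toSubring O)) (c : Fin p → K),
        (∃ j : Fin p, (j : ℕ) ≠ 0 ∧ c j ≠ 0) ∧
        ((∃ (d m : ℕ) (hmd : m ≤ d) (t : Fin d → ↥(locAtCentre A'.toSubring O)) (a : Fin m → ℕ)
            (u : ↥(locAtCentre A'.toSubring O)), IsUnit u ∧
            Ideal.span (Set.range t) = IsLocalRing.maximalIdeal ↥(locAtCentre A'.toSubring O) ∧
            ringKrullDim ↥(locAtCentre A'.toSubring O) = (d : WithBot ℕ∞) ∧ 0 < m ∧ (∀ i, ¬ p ∣ a i) ∧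
            (∑ j : Fin p, c j ^ p * g₀ ^ (j : ℕ)) =
              (u : K) * ∏ i : Fin m, ((t (Fin.castLE hmd i) : ↥(locAtCentre A'.toSubring O)) : K) ^ (a i)) ∨
          (∃ u : ↥(locAtCentre A'.toSubring O), IsUnit u ∧ (∑ j : Fin p, c j ^ p * g₀ ^ (j : ℕ)) = (u : K) ∧
            ∀ c' : ↥(locAtCentre A'.toSubring O), u - c' ^ p ∉ IsLocalRing.maximalIdeal ↥(locAtCentre A'.toSubring O)) ∨
          (∃ s c' : ↥(locAtCentre A'.toSubring O), (∑ j : Fin p, c j ^ p * g₀ ^ (j : ℕ)) = (s : K) ∧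
            s - c' ^ p ∈ IsLocalRing.maximalIdeal ↥(locAtCentre A'.toSubring O) ∧
            s - c' ^ p ∉ IsLocalRing.maximalIdeal ↥(locAtCentre A'.toSubring O) ^ 2))

/-- **Clean LU at 3-dimensional centres at the prime `p`** (= the registered `stub_cleanLU3Defect` of Sketch rev 17 at `p`
WITHOUT its immediacy hypothesis, i.e. the old `stub_cleanLU3` at `p`; conclusion folded into `CleanLUConcl`). [folklore] -/
def CleanLU3At (p : ℕ) : Prop :=
    ∀ (k : Type) [Field k] [CharP k p] (K : Type) [Field K] [Algebra k K]
    (O : ValuationSubring K) (A : Subalgebra k K), A.toSubring ≤ O.toSubring → A.FG → IsFractionRing A K →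
    ringKrullDim A ≤ 3 → IsRegularLocalRing (locAtCentre A.toSubring O) →
    ringKrullDim (locAtCentre A.toSubring O) = 3 →
    ∀ g₀ : K, (∀ c : K, c ^ p ≠ g₀) → CleanLUConcl p k K O A g₀

/-- **The research residue `stub_cleanLU3Defect` at the prime `p`** (Sketch rev 17, verbatim up to folding the conclusion):
clean LU at 3-dimensional centres for valuations at which the line of `g₀` is IMMEDIATE. [folklore] -/
def CleanLU3DefectAt (p : ℕ) : Prop :=
    ∀ (k : Type) [Field k] [CharP k p] (K : Type) [Field K] [Algebra k K]
    (O : ValuationSubring K) (A : Subalgebra k K), A.toSubring ≤ O.toSubring → A.FG → IsFractionRing A K →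
    ringKrullDim A ≤ 3 → IsRegularLocalRing (locAtCentre A.toSubring O) →
    ringKrullDim (locAtCentre A.toSubring O) = 3 →
    ∀ g₀ : K, (∀ c : K, c ^ p ≠ g₀) →
    (∀ f₀ : K, ∃ f₁ : K, O.valuation (g₀ - f₁ ^ p) < O.valuation (g₀ - f₀ ^ p)) →
    CleanLUConcl p k K O A g₀

/-- The residue is a special case of clean LU at 3-dimensional centres (drop the immediacy hypothesis). [folklore] -/
theorem cleanLU3DefectAt_of_cleanLU3At (p : ℕ) (h : CleanLU3At p) : CleanLU3DefectAt p :=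
  fun k _ _ K _ _ O A hAO hAfg hfrac hdimA hreg hdim3 g₀ hg₀ _ =>
    h k K O A hAO hAfg hfrac hdimA hreg hdim3 g₀ hg₀

/-- **The residual for `p ≥ 3`: from multiplicity `< p` to clean** — at a REGULAR centre (any dimension) of a finitely generated
model `A ⊆ O`, if the line of `g₀` has a representative `C^p g₀ + D^p ∈ A_𝔭` (`C ≠ 0`) of multiplicity `< p` there
(`∀ c, (C^p g₀ + D^p) - c^p ∉ 𝔪^p`), then the clean-LU conclusion holds at `O`.  A special case of clean local uniformization
at regular centres (itself equivalent to `CleanLU3` on regular threefold models, ✓ `cleanLU_of_cleanLU3_dimThreeCentres`);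
OPEN for `p ≥ 3` (immediate valuations), trivially true at `p = 2` (`lowMultToCleanAt_two`). [folklore] -/
def LowMultToCleanAt (p : ℕ) : Prop :=
    ∀ (k : Type) [Field k] [CharP k p] (K : Type) [Field K] [Algebra k K]
    (O : ValuationSubring K) (A : Subalgebra k K), A.toSubring ≤ O.toSubring → A.FG → IsFractionRing A K →
    ∀ (_hreg : IsRegularLocalRing (locAtCentre A.toSubring O)),
    ∀ g₀ : K, (∀ c : K, c ^ p ≠ g₀) →
    (∃ (C D : K) (hG : C ^ p * g₀ + D ^ p ∈ locAtCentre A.toSubring O), C ≠ 0 ∧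
      ∀ c : ↥(locAtCentre A.toSubring O),
        (⟨C ^ p * g₀ + D ^ p, hG⟩ : ↥(locAtCentre A.toSubring O)) - c ^ p ∉
          IsLocalRing.maximalIdeal ↥(locAtCentre A.toSubring O) ^ p) →
    CleanLUConcl p k K O A g₀

/-- **At `p = 2` the residual is trivially true**: `G - c² ∉ 𝔪²` for every `c` is loose clean form (3) (if some `G - c² ∈ 𝔪`)
or form (2) (else `G` is a unit whose residue is not a square) AT THE CENTRE ITSELF (`A' = A`). [folklore] -/
theorem lowMultToCleanAt_two : LowMultToCleanAt 2 := by
  intro k _ _ K _ _ O A hAO hAfg hfrac hreg g₀ hg₀ hrep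
  obtain ⟨C, D, hG, hC, hmult⟩ := hrep
  set R : Subring K := locAtCentre A.toSubring O with hRdef
  haveI := hreg
  let G : R := ⟨C ^ 2 * g₀ + D ^ 2, hG⟩
  let cvec : Fin 2 → K := fun j => if (j : ℕ) = 1 then C else D
  have hsum : (∑ j : Fin 2, cvec j ^ 2 * g₀ ^ (j : ℕ)) = (G : K) := by
    rw [Fin.sum_univ_two]
    simp [cvec, G]
    ring
  refine ⟨A, hAO, le_rfl, hAfg, hreg, cvec, ⟨1, by simp, by simpa [cvec] using hC⟩, ?_⟩
  by_cases h : ∃ c' : R, G - c' ^ 2 ∈ IsLocalRing.maximalIdeal R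
  · obtain ⟨c', hc'⟩ := h
    exact Or.inr (Or.inr ⟨G, c', hsum, hc', hmult c'⟩)
  · push Not at h
    have hGunit : IsUnit G := by
      by_contra hnu
      apply h 0
      rw [zero_pow two_ne_zero, sub_zero]
      exact (IsLocalRing.mem_maximalIdeal G).mpr hnu
    exact Or.inr (Or.inl ⟨G, hGunit, hsum, h⟩)

/-- **The END STATE of the printed phase, in the customer's currency (rev 1.6 refactoring of the g6 composition).**  From
`CpBaseSidePhaseAt p` at a 3-dimensional regular centre of a finitely generated model `A ⊆ O`: a finitely generated enlargement
`A ⊆ A' ⊆ O` (`A' = A[t]`, `t` the chart generators of the tower), regular at the centre of `O`, whose local ring there is CP's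
`B_n` and carries a representative `C^p g₀ + D^p` (`C ≠ 0`) of the `K^p`-line of `g₀` of multiplicity `< p`
(`∀ c, (C^p g₀ + D^p) - c^p ∉ 𝔪^p`).  The plumbing (the local ring `S = A_𝔭` is excellent regular of dimension 3 with
`Frac = K`, the radicand is moved into `S`, the tower is a chain of local blowing ups) is that of ✓
`cleanLU_of_frame_of_dimThreeCentre`. [folklore] -/
theorem exists_lowMultModel_of_baseSidePhaseAt (p : ℕ) (hp : p.Prime) (hBS : CpBaseSidePhaseAt.{0} p)
    (k : Type) [Field k] [CharP k p] (K : Type) [Field K] [Algebra k K]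
    (O : ValuationSubring K) (A : Subalgebra k K) (hAO : A.toSubring ≤ O.toSubring) (hAfg : A.FG)
    (hfrac : IsFractionRing A K) (hreg : IsRegularLocalRing (locAtCentre A.toSubring O))
    (hdim3 : ringKrullDim (locAtCentre A.toSubring O) = 3) (g₀ : K) (hg₀ : ∀ c : K, c ^ p ≠ g₀) :
    ∃ (A' : Subalgebra k K) (_ : A'.toSubring ≤ O.toSubring) (_ : A ≤ A') (_ : A'.FG) (_ : IsFractionRing A' K)
      (_ : IsRegularLocalRing (locAtCentre A'.toSubring O))
      (C D : K) (hG : C ^ p * g₀ + D ^ p ∈ locAtCentre A'.toSubring O), C ≠ 0 ∧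
        ∀ c : ↥(locAtCentre A'.toSubring O),
          (⟨C ^ p * g₀ + D ^ p, hG⟩ : ↥(locAtCentre A'.toSubring O)) - c ^ p ∉
            IsLocalRing.maximalIdeal ↥(locAtCentre A'.toSubring O) ^ p := by
  classical
  haveI : Fact p.Prime := ⟨hp⟩
  haveI := hreg
  set S : Subring K := locAtCentre A.toSubring O with hSdef
  have hSO : S ≤ O.toSubring := locAtCentre_le hAO
  have hAS : A.toSubring ≤ S := le_locAtCentre A.toSubring O
  -- characteristic
  haveI : CharP K p := charP_of_injective_algebraMap (algebraMap k K).injective p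
  haveI hSp : CharP S p := (S.subtype).charP Subtype.val_injective p
  -- `S` is excellent: a localisation of the finitely generated `k`-algebra `A`
  haveI : Algebra.FiniteType k A := (Subalgebra.fg_iff_finiteType A).mp hAfg
  have hexcA : IsExcellentRing A := isExcellentRing_of_finiteType_field k A
  haveI := isLocalization_locAtCentre (K := K) (O := O) hAO
  have hexcS : IsExcellentRing S :=
    IsExcellentRing.of_isLocalization (A := A.toSubring) (B := S) (subringCentre A.toSubring O hAO).primeCompl hexcA
  -- `K = Frac S`
  haveI : IsFractionRing S K := by
    refine IsFractionRing.of_field S K fun z => ?_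
    obtain ⟨a, b, -, hab⟩ := IsFractionRing.div_surjective (A := A) z
    exact ⟨⟨a, hAS a.2⟩, ⟨b, hAS b.2⟩, hab.symm⟩
  -- the radicand moved into `A ⊆ S`: `g₀ = a / b`, `f = a b^{p-1} = b^p g₀`
  obtain ⟨a, b, hb, hab⟩ := IsFractionRing.div_surjective (A := A) g₀
  have hb0 : (b : K) ≠ 0 := by
    intro h
    have : (b : A) = 0 := Subtype.ext h
    exact (nonZeroDivisors.ne_zero hb) this
  have hab' : g₀ = (a : K) / (b : K) := hab.symm
  set f : S := ⟨(a : K) * (b : K) ^ (p - 1), S.mul_mem (hAS a.2) (S.pow_mem (hAS b.2) _)⟩ with hfdef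
  have hfK : ((f : S) : K) = (b : K) ^ p * g₀ := by
    rw [hfdef, hab']
    have : (b : K) ^ p = (b : K) ^ (p - 1) * b := by
      rw [← pow_succ, Nat.sub_add_cancel hp.one_lt.le]
    rw [this]
    field_simp
  have hfp : ∀ c : K, c ^ p ≠ algebraMap S K f := by
    intro c hc
    apply hg₀ (c / b)
    rw [div_pow, hc]
    change ((f : S) : K) / (b : K) ^ p = g₀
    rw [hfK]
    field_simp
  -- domination
  have hrange : (algebraMap S K).range ≤ O.toSubring := by
    rintro _ ⟨s, rfl⟩
    exact hSO s.2
  have hdom : ∀ s ∈ IsLocalRing.maximalIdeal S, O.valuation (algebraMap S K s) < 1 := by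
    intro s hs
    exact (mem_maximalIdeal_locAtCentre_iff hAO s).mp hs
  -- THE PRINTED PHASE
  obtain ⟨n, B, g, hB0, hg0, hBall, hstep, hend⟩ := hBS S hexcS hdim3 hSp K f hfp O hrange hdom
  have hrangeS : (algebraMap S K).range = S := by
    ext x
    constructor
    · rintro ⟨s, rfl⟩; exact s.2
    · intro hx; exact ⟨⟨x, hx⟩, rfl⟩
  have hB0' : B 0 = S := by rw [hB0, hrangeS, hSdef, locAtCentre_locAtCentre]
  -- the tower is a chain of local blowing ups; `B n` is the local ring at the centre of a finitely generated model
  obtain ⟨hT, hBnloc⟩ := reflTransGen_of_steps O B n (by rw [hB0', hSdef, locAtCentre_locAtCentre])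
    (fun i hi => by obtain ⟨P, -, hP, -⟩ := hstep i hi; exact ⟨P, hP⟩)
  obtain ⟨-, t, htO, hBn⟩ := exists_eq_locAtCentre_of_reflTransGen (by rw [hB0']; exact hSO) hT
  rw [hBnloc, hB0', hSdef, PfaffLine.locAtCentre_closure_locAtCentre_union] at hBn
  -- the finitely generated model `A' = A[t]`
  let A' : Subalgebra k K :=
    { Subring.closure ((A.toSubring : Set K) ∪ ↑t) with
      algebraMap_mem' := fun r => Subring.subset_closure (Or.inl (A.algebraMap_mem r)) }
  have hA'sub : A'.toSubring = Subring.closure ((A.toSubring : Set K) ∪ ↑t) := rfl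
  have hAA' : A ≤ A' := fun x hx => Subring.subset_closure (Or.inl hx)
  have hA'O : A'.toSubring ≤ O.toSubring := by
    rw [hA'sub, Subring.closure_le]
    rintro x (hx | hx)
    · exact hAO hx
    · exact htO hx
  have hA'fg : A'.FG := by
    obtain ⟨s₀, hs₀⟩ := hAfg
    refine ⟨s₀ ∪ t, le_antisymm ?_ ?_⟩
    · rw [Algebra.adjoin_le_iff]
      rintro x hx
      rw [Finset.coe_union] at hx
      rcases hx with hx | hx
      · exact hAA' (hs₀ ▸ Algebra.subset_adjoin hx)
      · exact Subring.subset_closure (Or.inr hx)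
    · intro x hx
      change x ∈ Subring.closure ((A.toSubring : Set K) ∪ ↑t) at hx
      have hle : Subring.closure ((A.toSubring : Set K) ∪ ↑t) ≤ (Algebra.adjoin k (↑(s₀ ∪ t) : Set K)).toSubring := by
        rw [Subring.closure_le]
        rintro y (hy | hy)
        · have : y ∈ Algebra.adjoin k (s₀ : Set K) := by rw [hs₀]; exact hy
          exact Algebra.adjoin_mono (by rw [Finset.coe_union]; exact Set.subset_union_left) this
        · exact Algebra.subset_adjoin (by rw [Finset.coe_union]; exact Or.inr hy)
      exact hle hx
  have hBnA' : B n = locAtCentre A'.toSubring O := by rw [hA'sub]; exact hBn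
  have hfracA' : IsFractionRing A' K := by
    refine IsFractionRing.of_field A' K fun z => ?_
    obtain ⟨a₁, b₁, -, hab₁⟩ := IsFractionRing.div_surjective (A := A) z
    exact ⟨⟨a₁, hAA' a₁.2⟩, ⟨b₁, hAA' b₁.2⟩, hab₁.symm⟩
  -- facts about `B n`
  obtain ⟨hBnO, hBnreg, hgn⟩ := hBall n le_rfl
  have hregA' : IsRegularLocalRing (locAtCentre A'.toSubring O) := by rw [← hBnA']; exact hBnreg
  -- `g n` in the `K^p`-line of `f`, hence of `g₀`
  obtain ⟨C, D, hC, hline⟩ := exists_line_of_tower p (algebraMap S K f) g hg0 n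
    (fun i hi => by obtain ⟨-, -, -, hcd⟩ := hstep i hi; exact hcd)
  have hfK' : (algebraMap S K) f = (b : K) ^ p * g₀ := hfK
  have hGeq : (C * (b : K)) ^ p * g₀ + D ^ p = g n := by
    rw [hline, hfK', mul_pow]; ring
  have hgn' : g n ∈ locAtCentre A'.toSubring O := by rw [← hBnA']; exact hgn
  have hGmem : (C * (b : K)) ^ p * g₀ + D ^ p ∈ locAtCentre A'.toSubring O := by rw [hGeq]; exact hgn'
  -- the end-state `m < p`, transported to the local ring of `A'` at the centre
  have hend' : ∀ (hg : g n ∈ locAtCentre A'.toSubring O) (_h : IsRegularLocalRing ↥(locAtCentre A'.toSubring O))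
      (c : ↥(locAtCentre A'.toSubring O)),
      (⟨g n, hg⟩ : ↥(locAtCentre A'.toSubring O)) - c ^ p ∉
        IsLocalRing.maximalIdeal ↥(locAtCentre A'.toSubring O) ^ p := by
    rw [← hBnA']; exact hend
  haveI := hregA'
  have hmultG : ∀ c : ↥(locAtCentre A'.toSubring O),
      (⟨(C * (b : K)) ^ p * g₀ + D ^ p, hGmem⟩ : ↥(locAtCentre A'.toSubring O)) - c ^ p ∉
        IsLocalRing.maximalIdeal ↥(locAtCentre A'.toSubring O) ^ p := by
    intro c
    have heq : (⟨(C * (b : K)) ^ p * g₀ + D ^ p, hGmem⟩ : ↥(locAtCentre A'.toSubring O)) = ⟨g n, hgn'⟩ :=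
      Subtype.ext hGeq
    rw [heq]
    exact hend' hgn' hregA' c
  exact ⟨A', hA'O, hAA', hA'fg, hfracA', hregA', C * (b : K), D, hGmem, mul_ne_zero hC hb0, hmultG⟩

/-- **Composition (all `p`): printed phase + residual ⟹ clean LU at 3-dimensional centres.**  The end-state `m < p` of the
printed phase (`exists_lowMultModel_of_baseSidePhaseAt`) is handed to the residual at `A'`. [folklore] -/
theorem cleanLU3At_of_baseSidePhaseAt_of_lowMultToCleanAt (p : ℕ) (hp : p.Prime) (hBS : CpBaseSidePhaseAt.{0} p)
    (hLow : LowMultToCleanAt p) : CleanLU3At p := by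
  intro k _ _ K _ _ O A hAO hAfg hfrac _hdimA hreg hdim3 g₀ hg₀
  obtain ⟨A', hA'O, hAA', hA'fg, hfracA', hregA', C, D, hGmem, hC, hmultG⟩ :=
    exists_lowMultModel_of_baseSidePhaseAt p hp hBS k K O A hAO hAfg hfrac hreg hdim3 g₀ hg₀
  obtain ⟨A'', hA''O, hA'A'', hA''fg, hrest⟩ := hLow k K O A' hA'O hA'fg hfracA' hregA' g₀ hg₀ ⟨C, D, hGmem, hC, hmultG⟩
  exact ⟨A'', hA''O, hAA'.trans hA'A'', hA''fg, hrest⟩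

/-- **`p = 2` slice**: the printed phase alone gives clean LU at 3-dimensional centres in characteristic 2, for EVERY
valuation (immediate ones included) over EVERY field of characteristic 2. [folklore] -/
theorem cleanLU3At_two_of_baseSidePhaseAt_two (h : CpBaseSidePhaseAt.{0} 2) : CleanLU3At 2 :=
  cleanLU3At_of_baseSidePhaseAt_of_lowMultToCleanAt 2 Nat.prime_two h lowMultToCleanAt_two

/-- **The `p = 2` instance of the research residue `stub_cleanLU3Defect` follows from F-110 AT `p = 2`** (which, at `p = 2`,
is the printed theorem read base-side — module docstring).  The deciding input is a PRINTED theorem to be typed as a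
Literature fact by INPUTS; nothing is proved about characteristic `p ≥ 3` here. [folklore] -/
theorem cleanLU3DefectAt_two_of_frameAt_two (h : CpThm15iFrameAt.{0} 2) : CleanLU3DefectAt 2 :=
  cleanLU3DefectAt_of_cleanLU3At 2
    (cleanLU3At_two_of_baseSidePhaseAt_two (frameAt_two_iff_baseSidePhaseAt_two.mp h))

/-- **`p ≥ 3` bookkeeping**: the residue `stub_cleanLU3Defect` at `p` follows from the printed phase and the residual
`LowMultToCleanAt p` (where the research now sits for odd `p`). [folklore] -/
theorem cleanLU3DefectAt_of_baseSidePhaseAt_of_lowMultToCleanAt (p : ℕ) (hp : p.Prime) (hBS : CpBaseSidePhaseAt.{0} p)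
    (hLow : LowMultToCleanAt p) : CleanLU3DefectAt p :=
  cleanLU3DefectAt_of_cleanLU3At p (cleanLU3At_of_baseSidePhaseAt_of_lowMultToCleanAt p hp hBS hLow)

end Customer

/-! ## §3c Rev-22 currency (g8): the NON-DISCRETE residue `stub_cleanLU3DefectNonDiscrete` per prime, and its per-prime cut

Sketch rev 22 (a20320932482) :281 registers `stub_cleanLU3DefectNonDiscrete` = the rev-18 residue at a ZERO-DIMENSIONAL `O`
(`hzd`), of positive transcendence defect (`hdefect`), with no best `p`-th-power approximation (`htd`), which is NOT discrete of
rank one (`hdisc`; classes (B) rank one non-discrete, (C) composite).  Below: its body at one prime (verbatim, conclusion folded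
into `CleanLUConcl`), the `p = 2` tooth from the printed theorem read base-side, and the odd-`p` composition through the ONE
unprinted residual `LowMultToCleanNonDiscreteAt p`.  Nothing here is proved about that residual for `p ≥ 3`. -/
section Rev22

/-- **`stub_cleanLU3DefectNonDiscrete` (Sketch rev 22 :281) at the prime `p`** — hypotheses verbatim, conclusion folded into
`CleanLUConcl` (`cleanLU3DefectNonDiscreteAt_iff_rev22`).  A TARGET shape; RESEARCH for `p ≥ 3`. [folklore] -/
def CleanLU3DefectNonDiscreteAt (p : ℕ) : Prop :=
    ∀ (k : Type) [Field k] [CharP k p] (K : Type) [Field K] [Algebra k K]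
    (O : ValuationSubring K) (A : Subalgebra k K), A.toSubring ≤ O.toSubring → A.FG → IsFractionRing A K →
    ringKrullDim A ≤ 3 → IsRegularLocalRing (locAtCentre A.toSubring O) →
    ringKrullDim (locAtCentre A.toSubring O) = 3 →
    (∀ (T : Subring K) (hT : T ≤ O.toSubring), A.toSubring ≤ T → (subringCentre T O hT).IsMaximal) →
    ∀ g₀ : K, (∀ c : K, c ^ p ≠ g₀) →
    (∀ f₀ : K, ∃ f₁ : K, O.valuation (g₀ - f₁ ^ p) < O.valuation (g₀ - f₀ ^ p)) →
    (∀ hk : ∀ c : k, algebraMap k K c ∈ O, transcendenceDefect k O hk ≠ 0) →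
    ¬ (∃ π : K, π ≠ 0 ∧ (∀ x : K, O.valuation x < 1 → O.valuation x ≤ O.valuation π) ∧
      (∀ x : K, x ≠ 0 → ∃ n : ℕ, O.valuation π ^ n ≤ O.valuation x)) →
    CleanLUConcl p k K O A g₀

/-- The per-prime body IS the registered rev-22 statement at `p` (definitional unfolding of `CleanLUConcl`; the right-hand
side is `stub_cleanLU3DefectNonDiscrete`'s text with its leading `∀ (p : ℕ), p.Prime →` removed). [folklore] -/
theorem cleanLU3DefectNonDiscreteAt_iff_rev22 (p : ℕ) : CleanLU3DefectNonDiscreteAt p ↔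
    ∀ (k : Type) [Field k] [CharP k p] (K : Type) [Field K] [Algebra k K]
    (O : ValuationSubring K) (A : Subalgebra k K), A.toSubring ≤ O.toSubring → A.FG → IsFractionRing A K →
    ringKrullDim A ≤ 3 → IsRegularLocalRing (locAtCentre A.toSubring O) →
    ringKrullDim (locAtCentre A.toSubring O) = 3 →
    (∀ (T : Subring K) (hT : T ≤ O.toSubring), A.toSubring ≤ T → (subringCentre T O hT).IsMaximal) →
    ∀ g₀ : K, (∀ c : K, c ^ p ≠ g₀) →
    (∀ f₀ : K, ∃ f₁ : K, O.valuation (g₀ - f₁ ^ p) < O.valuation (g₀ - f₀ ^ p)) →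
    (∀ hk : ∀ c : k, algebraMap k K c ∈ O, transcendenceDefect k O hk ≠ 0) →
    ¬ (∃ π : K, π ≠ 0 ∧ (∀ x : K, O.valuation x < 1 → O.valuation x ≤ O.valuation π) ∧
      (∀ x : K, x ≠ 0 → ∃ n : ℕ, O.valuation π ^ n ≤ O.valuation x)) →
    ∃ (A' : Subalgebra k K), A'.toSubring ≤ O.toSubring ∧ A ≤ A' ∧ A'.FG ∧
    ∃ (_ : IsRegularLocalRing (locAtCentre A'.toSubring O)) (c : Fin p → K), (∃ j : Fin p, (j : ℕ) ≠ 0 ∧ c j ≠ 0) ∧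
    ((∃ (d m : ℕ) (hmd : m ≤ d) (t : Fin d → ↥(locAtCentre A'.toSubring O)) (a : Fin m → ℕ) (u : ↥(locAtCentre A'.toSubring O)), IsUnit u ∧
    Ideal.span (Set.range t) = IsLocalRing.maximalIdeal ↥(locAtCentre A'.toSubring O) ∧
    ringKrullDim ↥(locAtCentre A'.toSubring O) = (d : WithBot ℕ∞) ∧ 0 < m ∧ (∀ i, ¬ p ∣ a i) ∧
    (∑ j : Fin p, c j ^ p * g₀ ^ (j : ℕ)) = (u : K) * ∏ i : Fin m, ((t (Fin.castLE hmd i) : ↥(locAtCentre A'.toSubring O)) : K) ^ (a i)) ∨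
    (∃ u : ↥(locAtCentre A'.toSubring O), IsUnit u ∧ (∑ j : Fin p, c j ^ p * g₀ ^ (j : ℕ)) = (u : K) ∧
    ∀ c' : ↥(locAtCentre A'.toSubring O), u - c' ^ p ∉ IsLocalRing.maximalIdeal ↥(locAtCentre A'.toSubring O)) ∨
    (∃ s c' : ↥(locAtCentre A'.toSubring O), (∑ j : Fin p, c j ^ p * g₀ ^ (j : ℕ)) = (s : K) ∧
    s - c' ^ p ∈ IsLocalRing.maximalIdeal ↥(locAtCentre A'.toSubring O) ∧
    s - c' ^ p ∉ IsLocalRing.maximalIdeal ↥(locAtCentre A'.toSubring O) ^ 2)) :=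
  Iff.rfl

/-- The rev-22 residue at `p` is a special case of the rev-17 residue at `p` (drop `hzd`, `hdefect`, `hdisc`). [folklore] -/
theorem cleanLU3DefectNonDiscreteAt_of_cleanLU3DefectAt (p : ℕ) (h : CleanLU3DefectAt p) :
    CleanLU3DefectNonDiscreteAt p :=
  fun k _ _ K _ _ O A hAO hAfg hfrac hdimA hreg hdim3 _ g₀ hg₀ htd _ _ =>
    h k K O A hAO hAfg hfrac hdimA hreg hdim3 g₀ hg₀ htd

/-- **`p = 2` tooth of the rev-22 residue ⟸ the printed phase at `p = 2`** (= Thm 1.5 (i) at `p = 2` read base-side, F-112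
in INPUTS' numbering; every blow-up of the printed proof is in Prop 2.22's square because the `[31]`-phase `1 < m < p` is
empty at `p = 2`).  Classes (B)/(C) and immediate radicands included, over EVERY field of characteristic 2. [folklore] -/
theorem cleanLU3DefectNonDiscreteAt_two_of_baseSidePhaseAt_two (h : CpBaseSidePhaseAt.{0} 2) :
    CleanLU3DefectNonDiscreteAt 2 :=
  cleanLU3DefectNonDiscreteAt_of_cleanLU3DefectAt 2
    (cleanLU3DefectAt_of_cleanLU3At 2 (cleanLU3At_two_of_baseSidePhaseAt_two h))

/-- **`p = 2` tooth ⟸ the frame at `p = 2`** (`frameAt_two_iff_baseSidePhaseAt_two`). [folklore] -/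
theorem cleanLU3DefectNonDiscreteAt_two_of_frameAt_two (h : CpThm15iFrameAt.{0} 2) : CleanLU3DefectNonDiscreteAt 2 :=
  cleanLU3DefectNonDiscreteAt_two_of_baseSidePhaseAt_two (frameAt_two_iff_baseSidePhaseAt_two.mp h)

/-- **The ONE unprinted residual of classes (B)/(C) at odd `p` in dimension 3: from multiplicity `< p` to loosely clean along
a zero-dimensional NON-DISCRETE valuation ring.**  At a REGULAR centre of a finitely generated model `A ⊆ O` (the rev-22
hypotheses on `O` and `g₀` verbatim: `O` zero-dimensional on every model above `A`, `g₀ ∉ K^p` with no best `p`-th-power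
approximation, positive transcendence defect, `O` not discrete of rank one), IF the `K^p`-line of `g₀` has a representative
`C^p g₀ + D^p` (`C ≠ 0`) of multiplicity `< p` in the local ring, THEN the clean-LU conclusion holds.  RESEARCH for `p ≥ 3`
(termination of the alternation «monomialise `G - e^p` / read off forms (1)–(2) / re-approximate `e`» without a uniformizer);
NOT a corollary of Cossart–Piltant 2019 Thm 1.5 (i) + Prop 2.22 (Cor 5.6: the printed proof treats `1 < m < p` by [31] in the
regular fourfold, outside the square (2.17)); discrete `O`: THEOREM P (all fields); defectless `O`: ✓p677129.  Trivially true
at `p = 2` (`lowMultToCleanNonDiscreteAt_two`). [folklore] -/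
def LowMultToCleanNonDiscreteAt (p : ℕ) : Prop :=
    ∀ (k : Type) [Field k] [CharP k p] (K : Type) [Field K] [Algebra k K]
    (O : ValuationSubring K) (A : Subalgebra k K), A.toSubring ≤ O.toSubring → A.FG → IsFractionRing A K →
    ∀ (_hreg : IsRegularLocalRing (locAtCentre A.toSubring O)),
    (∀ (T : Subring K) (hT : T ≤ O.toSubring), A.toSubring ≤ T → (subringCentre T O hT).IsMaximal) →
    ∀ g₀ : K, (∀ c : K, c ^ p ≠ g₀) →
    (∀ f₀ : K, ∃ f₁ : K, O.valuation (g₀ - f₁ ^ p) < O.valuation (g₀ - f₀ ^ p)) →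
    (∀ hk : ∀ c : k, algebraMap k K c ∈ O, transcendenceDefect k O hk ≠ 0) →
    ¬ (∃ π : K, π ≠ 0 ∧ (∀ x : K, O.valuation x < 1 → O.valuation x ≤ O.valuation π) ∧
      (∀ x : K, x ≠ 0 → ∃ n : ℕ, O.valuation π ^ n ≤ O.valuation x)) →
    (∃ (C D : K) (hG : C ^ p * g₀ + D ^ p ∈ locAtCentre A.toSubring O), C ≠ 0 ∧
      ∀ c : ↥(locAtCentre A.toSubring O),
        (⟨C ^ p * g₀ + D ^ p, hG⟩ : ↥(locAtCentre A.toSubring O)) - c ^ p ∉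
          IsLocalRing.maximalIdeal ↥(locAtCentre A.toSubring O) ^ p) →
    CleanLUConcl p k K O A g₀

/-- The non-discrete residual is a special case of the g6 residual `LowMultToCleanAt p` (drop the four `O`-hypotheses).
[folklore] -/
theorem lowMultToCleanNonDiscreteAt_of_lowMultToCleanAt (p : ℕ) (h : LowMultToCleanAt p) :
    LowMultToCleanNonDiscreteAt p :=
  fun k _ _ K _ _ O A hAO hAfg hfrac hreg _ g₀ hg₀ _ _ _ hrep => h k K O A hAO hAfg hfrac hreg g₀ hg₀ hrep

/-- At `p = 2` the non-discrete residual is trivially true (`lowMultToCleanAt_two`). [folklore] -/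
theorem lowMultToCleanNonDiscreteAt_two : LowMultToCleanNonDiscreteAt 2 :=
  lowMultToCleanNonDiscreteAt_of_lowMultToCleanAt 2 lowMultToCleanAt_two

/-- **Odd-`p` composition: printed phase + the non-discrete residual ⟹ the rev-22 residue at `p`.**  The four
`O`-hypotheses pass unchanged to the enlarged model `A' ⊇ A` delivered by `exists_lowMultModel_of_baseSidePhaseAt`
(zero-dimensionality is asked only of models above `A`, hence above `A'`). [folklore] -/
theorem cleanLU3DefectNonDiscreteAt_of_baseSidePhaseAt_of_lowMult (p : ℕ) (hp : p.Prime) (hBS : CpBaseSidePhaseAt.{0} p)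
    (hLow : LowMultToCleanNonDiscreteAt p) : CleanLU3DefectNonDiscreteAt p := by
  intro k _ _ K _ _ O A hAO hAfg hfrac _hdimA hreg hdim3 hzd g₀ hg₀ htd hdefect hdisc
  obtain ⟨A', hA'O, hAA', hA'fg, hfracA', hregA', C, D, hGmem, hC, hmultG⟩ :=
    exists_lowMultModel_of_baseSidePhaseAt p hp hBS k K O A hAO hAfg hfrac hreg hdim3 g₀ hg₀
  have hAA's : A.toSubring ≤ A'.toSubring := fun x hx => hAA' hx
  obtain ⟨A'', hA''O, hA'A'', hA''fg, hrest⟩ :=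
    hLow k K O A' hA'O hA'fg hfracA' hregA' (fun T hT hA'T => hzd T hT (hAA's.trans hA'T)) g₀ hg₀ htd hdefect hdisc
      ⟨C, D, hGmem, hC, hmultG⟩
  exact ⟨A'', hA''O, hAA'.trans hA'A'', hA''fg, hrest⟩

/-- **THE PER-PRIME CUT of `stub_cleanLU3DefectNonDiscrete`** (all primes at once): the printed phase at every prime (an
INPUTS-typable family, derivation form) and the non-discrete residual at every ODD prime (OURS, research) give the rev-22
residue at every prime; at `p = 2` the residual is not needed. [folklore] -/
theorem cleanLU3DefectNonDiscreteAt_of_inputs (hBS : ∀ p : ℕ, p.Prime → CpBaseSidePhaseAt.{0} p)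
    (hLow : ∀ p : ℕ, p.Prime → p ≠ 2 → LowMultToCleanNonDiscreteAt p) :
    ∀ p : ℕ, p.Prime → CleanLU3DefectNonDiscreteAt p := by
  intro p hp
  by_cases h2 : p = 2
  · subst h2
    exact cleanLU3DefectNonDiscreteAt_two_of_baseSidePhaseAt_two (hBS 2 Nat.prime_two)
  · exact cleanLU3DefectNonDiscreteAt_of_baseSidePhaseAt_of_lowMult p hp (hBS p hp) (hLow p hp h2)

/-- Variant with the frame at `p = 2` as the `p = 2` input (F-112 in frame form) and the phase only at odd primes. [folklore] -/
theorem cleanLU3DefectNonDiscreteAt_of_frameAt_two_of_odd (hF2 : CpThm15iFrameAt.{0} 2)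
    (hBS : ∀ p : ℕ, p.Prime → p ≠ 2 → CpBaseSidePhaseAt.{0} p)
    (hLow : ∀ p : ℕ, p.Prime → p ≠ 2 → LowMultToCleanNonDiscreteAt p) :
    ∀ p : ℕ, p.Prime → CleanLU3DefectNonDiscreteAt p := by
  intro p hp
  by_cases h2 : p = 2
  · subst h2
    exact cleanLU3DefectNonDiscreteAt_two_of_frameAt_two hF2
  · exact cleanLU3DefectNonDiscreteAt_of_baseSidePhaseAt_of_lowMult p hp (hBS p hp h2) (hLow p hp h2)

end Rev22

/-! ## Class (A), arcs (rev 1.3 rational / rev 1.4 perfect ground field; typed TARGETS only — the hand proof is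
`Cruxes/DescentPerfectToAll/CLASSA-rational-arcs-lens5.md`; nothing is proved here)

The line lead's rev-18 residue `stub_cleanLU3Defect` restricts to zero-dimensional valuation rings of
transcendence defect `≠ 0` with no best `p`-th-power approximation; its class (A) = DISCRETE rank one («arcs»).
For RATIONAL arcs (residue field of `O` = `k`; all of class (A) when `k` is algebraically closed) the hand
proof gives loose-clean form (1) after `α` point blow-ups, in any dimension and for every `p`, with no
Cossart–Piltant input.  The two extra hypotheses are typed elementarily below. -/
section ClassA

/-- `O` is DISCRETE OF RANK ONE: some `π` of value `< 1` such that every nonzero value is an integral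
power of `v(π)` (then `v(π)` is the largest value `< 1` and the value group is `ℤ`). [folklore] -/
def IsDiscreteRankOne {K : Type} [Field K] (O : ValuationSubring K) : Prop :=
  ∃ π : K, O.valuation π < 1 ∧ ∀ y : K, y ≠ 0 → ∃ n : ℤ, O.valuation y = O.valuation π ^ n

/-- `O` is RATIONAL over `k`: every element of `O` is congruent to a constant of `k` modulo `𝔪_O`
(residue field of `O` = `k`). [folklore] -/
def IsRationalOver (k : Type) {K : Type} [Field k] [Field K] [Algebra k K] (O : ValuationSubring K) : Prop :=
  ∀ r : K, O.valuation r ≤ 1 → ∃ a : k, O.valuation (r - algebraMap k K a) < 1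

/-- TYPED TARGET (class (A), rational arcs; hand proof in `CLASSA-rational-arcs-lens5.md`, NOT kernel-checked):
for a prime `p`, any field `k` of characteristic `p`, `A` finitely generated with fraction field `K`,
`O ⊇ A` a discrete rank-one valuation ring RATIONAL over `k`, `locAtCentre A O` regular (ANY dimension),
and `g₀ ∉ K^p` WITHOUT best `p`-th-power approximation, the clean-LU conclusion `CleanLUConcl` holds
(indeed in form (1)).  Slots under the rev-18 `stub_cleanLU3Defect` as the sub-case (A) ∧ rational —
note it carries NO `ringKrullDim` hypotheses. [conjecture] -/
def CleanLUDefectRationalArcAt (p : ℕ) : Prop :=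
    ∀ (k : Type) [Field k] [CharP k p] (K : Type) [Field K] [Algebra k K]
    (O : ValuationSubring K) (A : Subalgebra k K), A.toSubring ≤ O.toSubring → A.FG → IsFractionRing A K →
    IsRegularLocalRing (locAtCentre A.toSubring O) →
    IsDiscreteRankOne O → IsRationalOver k O →
    ∀ g₀ : K, (∀ c : K, c ^ p ≠ g₀) →
    (∀ f₀ : K, ∃ f₁ : K, O.valuation (g₀ - f₁ ^ p) < O.valuation (g₀ - f₀ ^ p)) →
    CleanLUConcl p k K O A g₀

/-- Bookkeeping: the rational-arc target settles the rational-arc SLICE of the residue `CleanLU3DefectAt p`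
(the slice being the residue with the two extra hypotheses added). [folklore] -/
theorem cleanLU3DefectAt_slice_of_rationalArc (p : ℕ) (h : CleanLUDefectRationalArcAt p) :
    ∀ (k : Type) [Field k] [CharP k p] (K : Type) [Field K] [Algebra k K]
    (O : ValuationSubring K) (A : Subalgebra k K), A.toSubring ≤ O.toSubring → A.FG → IsFractionRing A K →
    ringKrullDim A ≤ 3 → IsRegularLocalRing (locAtCentre A.toSubring O) →
    ringKrullDim (locAtCentre A.toSubring O) = 3 →
    IsDiscreteRankOne O → IsRationalOver k O →
    ∀ g₀ : K, (∀ c : K, c ^ p ≠ g₀) →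
    (∀ f₀ : K, ∃ f₁ : K, O.valuation (g₀ - f₁ ^ p) < O.valuation (g₀ - f₀ ^ p)) →
    CleanLUConcl p k K O A g₀ :=
  fun k _ _ K _ _ O A hAO hAfg hfrac _ hreg _ hdisc hrat g₀ hg₀ himm =>
    h k K O A hAO hAfg hfrac hreg hdisc hrat g₀ hg₀ himm

/-- TYPED TARGET rev 1.4 (the WHOLE class (A) over a PERFECT ground field; hand proof = §7 of
`CLASSA-rational-arcs-lens5.md` rev 2, NOT kernel-checked): as `CleanLUDefectRationalArcAt` but with
rationality of `O` replaced by perfectness of `k` (stated elementarily: every element of `k` is a `p`-th power).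
Mechanism: window argument at stage `N = pL − α + 1`, approximant built from residues of stage `N − 1`
(index gain `η_i ∈ κ_{pi−α}`) lifted `x`-adically.  No `ringKrullDim` hypotheses, every `p`. [conjecture] -/
def CleanLUDefectArcAt (p : ℕ) : Prop :=
    ∀ (k : Type) [Field k] [CharP k p] (K : Type) [Field K] [Algebra k K]
    (O : ValuationSubring K) (A : Subalgebra k K), A.toSubring ≤ O.toSubring → A.FG → IsFractionRing A K →
    IsRegularLocalRing (locAtCentre A.toSubring O) →
    (∀ a : k, ∃ b : k, b ^ p = a) → IsDiscreteRankOne O →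
    (∀ (T : Subring K) (hT : T ≤ O.toSubring), A.toSubring ≤ T → (subringCentre T O hT).IsMaximal) →
    ∀ g₀ : K, (∀ c : K, c ^ p ≠ g₀) →
    (∀ f₀ : K, ∃ f₁ : K, O.valuation (g₀ - f₁ ^ p) < O.valuation (g₀ - f₀ ^ p)) →
    CleanLUConcl p k K O A g₀

/-- Bookkeeping: the arc target settles the «perfect `k`, discrete rank one, residually algebraic» SLICE of the
residue `CleanLU3DefectAt p`. (rev 1.5a: the zero-dimensionality hypothesis is now the lead's `hzd` VERBATIM — every centre above `A` is a closed
point; the rev-1.4 line `∀ r, v r ≤ 1 → ∃ q ≠ 0, v (q(r)) < 1` was too weak: it is satisfied vacuously by a constant `q ∈ centre`.) [folklore] -/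
theorem cleanLU3DefectAt_slice_of_arc (p : ℕ) (h : CleanLUDefectArcAt p) :
    ∀ (k : Type) [Field k] [CharP k p] (K : Type) [Field K] [Algebra k K]
    (O : ValuationSubring K) (A : Subalgebra k K), A.toSubring ≤ O.toSubring → A.FG → IsFractionRing A K →
    ringKrullDim A ≤ 3 → IsRegularLocalRing (locAtCentre A.toSubring O) →
    ringKrullDim (locAtCentre A.toSubring O) = 3 →
    (∀ a : k, ∃ b : k, b ^ p = a) → IsDiscreteRankOne O →
    (∀ (T : Subring K) (hT : T ≤ O.toSubring), A.toSubring ≤ T → (subringCentre T O hT).IsMaximal) →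
    ∀ g₀ : K, (∀ c : K, c ^ p ≠ g₀) →
    (∀ f₀ : K, ∃ f₁ : K, O.valuation (g₀ - f₁ ^ p) < O.valuation (g₀ - f₀ ^ p)) →
    CleanLUConcl p k K O A g₀ :=
  fun k _ _ K _ _ O A hAO hAfg hfrac _ hreg _ hperf hdisc hzd g₀ hg₀ himm =>
    h k K O A hAO hAfg hfrac hreg hperf hdisc hzd g₀ hg₀ himm


/-! ### (rev 1.5) The two upstream inputs of §9′ of `CLASSA-rational-arcs-lens5.md`, typed as TARGETS (statements only)

Against the lead's landed `arc_core` (✓ p681465, no density hypothesis) the class-(A) slice with FINITE residue extension needs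
exactly: (U) the point-blow-up tower along a discrete rank-one zero-dimensional `O` captures any finitely many elements of `O` in a
REGULAR model (hence a uniformiser, and density once the residue field has stabilised), and (Der) a `k`-derivation detecting
non-`p`-th powers over a perfect ground field.  Both are stated here so that the lead can adopt or reshape the signatures; neither is
proved here. -/

/-- TARGET (U) «the arc tower exhausts `O`», finite-capture form: over a perfect field, along a discrete rank-one residually
algebraic `O`, every finite set of elements of `O` lies in some regular model `locAtCentre A' O` above `A` of the same dimension.
(Hand proof: `CLASSA-rational-arcs-lens5.md` §9′ LEMMA U — exact tower 7.0 plus the `ν = 0` Taylor term; for a rational arc the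
perfectness hypothesis is not needed.) [ours] -/
def ArcTowerCapturesAt (p : ℕ) : Prop :=
    ∀ (k : Type) [Field k] [CharP k p] (K : Type) [Field K] [Algebra k K]
    (O : ValuationSubring K) (A : Subalgebra k K), A.toSubring ≤ O.toSubring → A.FG → IsFractionRing A K →
    IsRegularLocalRing (locAtCentre A.toSubring O) →
    (∀ a : k, ∃ b : k, b ^ p = a) → IsDiscreteRankOne O →
    (∀ (T : Subring K) (hT : T ≤ O.toSubring), A.toSubring ≤ T → (subringCentre T O hT).IsMaximal) →
    ∀ S : Finset K, (∀ y ∈ S, y ∈ O) →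
    ∃ (A' : Subalgebra k K), A'.toSubring ≤ O.toSubring ∧ A ≤ A' ∧ A'.FG ∧
      IsRegularLocalRing (locAtCentre A'.toSubring O) ∧
      ringKrullDim (locAtCentre A'.toSubring O) = ringKrullDim (locAtCentre A.toSubring O) ∧
      ∀ y ∈ S, y ∈ locAtCentre A'.toSubring O

/-- Consequence shape used by `arc_core`'s wrapper: a regular model containing a UNIFORMISER of `O` (take `S = {π}`). [ours] -/
theorem exists_regular_model_with_uniformizer (p : ℕ) (hU : ArcTowerCapturesAt p)
    (k : Type) [Field k] [CharP k p] (K : Type) [Field K] [Algebra k K]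
    (O : ValuationSubring K) (A : Subalgebra k K) (hAO : A.toSubring ≤ O.toSubring) (hfg : A.FG) (hfr : IsFractionRing A K)
    (hreg : IsRegularLocalRing (locAtCentre A.toSubring O))
    (hperf : ∀ a : k, ∃ b : k, b ^ p = a) (hdisc : IsDiscreteRankOne O)
    (hzd : ∀ (T : Subring K) (hT : T ≤ O.toSubring), A.toSubring ≤ T → (subringCentre T O hT).IsMaximal) :
    ∃ (A' : Subalgebra k K) (π : K), A'.toSubring ≤ O.toSubring ∧ A ≤ A' ∧ A'.FG ∧
      IsRegularLocalRing (locAtCentre A'.toSubring O) ∧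
      ringKrullDim (locAtCentre A'.toSubring O) = ringKrullDim (locAtCentre A.toSubring O) ∧
      π ∈ locAtCentre A'.toSubring O ∧ O.valuation π < 1 ∧
      ∀ y : K, y ≠ 0 → ∃ n : ℤ, O.valuation y = O.valuation π ^ n := by
  classical
  obtain ⟨π, hπlt, hπgen⟩ := hdisc
  have hπO : π ∈ O := (O.valuation_le_one_iff π).mp hπlt.le
  obtain ⟨A', hA'O, hAA', hA'fg, hreg', hdim', hmem⟩ :=
    hU k K O A hAO hfg hfr hreg hperf ⟨π, hπlt, hπgen⟩ hzd {π} (by simpa using hπO)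
  exact ⟨A', π, hA'O, hAA', hA'fg, hreg', hdim', hmem π (by simp), hπlt, hπgen⟩

/-- TARGET (Der) «derivations detect non-`p`-th powers over a perfect ground field»: for ANY extension field `K` of a perfect
field `k` of characteristic `p` and `h ∉ K^p` there is a `k`-derivation of `K` not vanishing at `h` (p-basis argument: every
derivation of `K` kills `K^p ⊇ k^p = k`; `{h}` is `p`-independent, extend to a `p`-basis and take `∂/∂h`).  For `K` the fraction
field of an essentially-finite-type `R`, clearing the finitely many denominators of `D` on generators gives the `s·D` preserving `R`
that `arc_core` consumes (`ArcTools.mul_derivation_mem_*`). [folklore] -/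
def DerivationDetectsAt (p : ℕ) : Prop :=
    ∀ (k : Type) [Field k] [CharP k p] (K : Type) [Field K] [Algebra k K],
    (∀ a : k, ∃ b : k, b ^ p = a) → ∀ h : K, (∀ c : K, c ^ p ≠ h) → ∃ D : Derivation k K K, D h ≠ 0

/-- Sanity direction (kernel): a derivation over ANY base kills `p`-th powers in characteristic `p`, so `(Der)` is sharp —
`D h ≠ 0` forces `h ∉ K^p`. [folklore] -/
theorem not_pthPower_of_derivation_ne_zero (p : ℕ)
    (k : Type) [Field k] (K : Type) [Field K] [CharP K p] [Algebra k K]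
    (D : Derivation k K K) (h : K) (hD : D h ≠ 0) : ∀ c : K, c ^ p ≠ h := by
  intro c hc
  apply hD
  rw [← hc, Derivation.leibniz_pow]
  simp [nsmul_eq_mul]

end ClassA


/-! ## §3d (rev 1.7, g8 2026-08-29) — exit tests for the odd-`p` residual: the affine-chart criterion (★) and the
K-rational sandwich, typed as SUPPORT statements (memo `ODDP-structure-lens5-g8.md` §2–§3, crux write 45efdca715f5).
Neither is a stub of the customer's line and neither is claimed to shrink `LowMultToCleanNonDiscreteAt p`; they are the
two exit tests a strategy for it would call, stated in the customer's currency `CleanLUConcl`.  `AffineChartCriterion` is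
elementary commutative algebra (provable, size M: adjoin `G`, localise at the centre, regularity of `S[V]_𝔫 ⧸ (qV − N)`);
`affineChart_cleanLUConcl` (PROVED here) feeds its output into `CleanLUConcl` as form (3) with `c' = 0`.
`KRatSandwichAt p` is the K-rational sandwich lemma (k perfect; Kunz + `Literature.RingTheory.PBasis.KunzConjectureReduction`),
unproved here (size M). Counted 0; nothing in this section bears on resolution in char `p` beyond vocabulary. -/

section OddP

/-- **(★) affine-chart criterion** (memo §2, direction (ii) ⟹ (i)): over a finitely generated `A' ⊆ O` regular at the centre,
if `G ∈ K` has positive value and a multiple `q * G` (`q` in the local ring at the centre) is a regular parameter there, then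
`G` is a regular parameter of the local ring at the centre of a finitely generated `A'' ⊇ A'` inside `O` (namely `A'[G]`).
Characteristic-free. [folklore] -/
def AffineChartCriterion : Prop :=
    ∀ (k : Type) [Field k] (K : Type) [Field K] [Algebra k K] (O : ValuationSubring K) (A' : Subalgebra k K)
    (_hA'O : A'.toSubring ≤ O.toSubring) (_hfg : A'.FG) (_hreg : IsRegularLocalRing (locAtCentre A'.toSubring O))
    (q G : K) (_hq : q ∈ locAtCentre A'.toSubring O) (hN : q * G ∈ locAtCentre A'.toSubring O),
      O.valuation G < 1 →
      (⟨q * G, hN⟩ : ↥(locAtCentre A'.toSubring O)) ∈ IsLocalRing.maximalIdeal ↥(locAtCentre A'.toSubring O) →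
      (⟨q * G, hN⟩ : ↥(locAtCentre A'.toSubring O)) ∉ IsLocalRing.maximalIdeal ↥(locAtCentre A'.toSubring O) ^ 2 →
      ∃ (A'' : Subalgebra k K), A' ≤ A'' ∧ A''.toSubring ≤ O.toSubring ∧ A''.FG ∧
        ∃ (_ : IsRegularLocalRing (locAtCentre A''.toSubring O)) (hG : G ∈ locAtCentre A''.toSubring O),
          (⟨G, hG⟩ : ↥(locAtCentre A''.toSubring O)) ∈ IsLocalRing.maximalIdeal ↥(locAtCentre A''.toSubring O) ∧
          (⟨G, hG⟩ : ↥(locAtCentre A''.toSubring O)) ∉ IsLocalRing.maximalIdeal ↥(locAtCentre A''.toSubring O) ^ 2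

/-- **The (★) search output, in the customer's currency**: the data a strategy for the odd-`p` residual has to FIND —
a finitely generated `A ≤ A' ⊆ O` regular at the centre, a non-trivial representative `G = Σ c_j^p g₀^j` of the `K^p`-line
of `g₀` of positive value, and `q` in the local ring with `q * G` a regular parameter. [folklore] -/
def AffineChartWitness (p : ℕ) (k K : Type) [Field k] [Field K] [Algebra k K] (O : ValuationSubring K)
    (A : Subalgebra k K) (g₀ : K) : Prop :=
    ∃ (A' : Subalgebra k K), A'.toSubring ≤ O.toSubring ∧ A ≤ A' ∧ A'.FG ∧
      ∃ (_ : IsRegularLocalRing (locAtCentre A'.toSubring O)) (c : Fin p → K) (q : K)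
        (_ : q ∈ locAtCentre A'.toSubring O)
        (hN : q * (∑ j : Fin p, c j ^ p * g₀ ^ (j : ℕ)) ∈ locAtCentre A'.toSubring O),
        (∃ j : Fin p, (j : ℕ) ≠ 0 ∧ c j ≠ 0) ∧
        O.valuation (∑ j : Fin p, c j ^ p * g₀ ^ (j : ℕ)) < 1 ∧
        (⟨_, hN⟩ : ↥(locAtCentre A'.toSubring O)) ∈ IsLocalRing.maximalIdeal ↥(locAtCentre A'.toSubring O) ∧
        (⟨_, hN⟩ : ↥(locAtCentre A'.toSubring O)) ∉ IsLocalRing.maximalIdeal ↥(locAtCentre A'.toSubring O) ^ 2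

/-- **(★) feeds the customer**: given the affine-chart criterion, an affine-chart witness yields `CleanLUConcl` — form (3)
with `c' = 0` for the same representative on the model `A'[G]`. [folklore] -/
theorem affineChart_cleanLUConcl (hAC : AffineChartCriterion) {p : ℕ} (hp : p.Prime) (k K : Type) [Field k] [Field K]
    [Algebra k K] (O : ValuationSubring K) (A : Subalgebra k K) (g₀ : K)
    (hW : AffineChartWitness p k K O A g₀) : CleanLUConcl p k K O A g₀ := by
  obtain ⟨A', hA'O, hAA', hfg, hreg, c, q, hq, hN, hj, hval, hmem, hnmem⟩ := hW
  obtain ⟨A'', hA'A'', hA''O, hfg'', hreg'', hG, hGmem, hGnmem⟩ :=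
    hAC k K O A' hA'O hfg hreg q _ hq hN hval hmem hnmem
  refine ⟨A'', hA''O, hAA'.trans hA'A'', hfg'', hreg'', c, hj, Or.inr (Or.inr ⟨⟨_, hG⟩, 0, rfl, ?_, ?_⟩)⟩
  · simpa [zero_pow hp.ne_zero] using hGmem
  · simpa [zero_pow hp.ne_zero] using hGnmem

/-- **K-rational sandwich at the prime `p`** (memo §3; `k` perfect): if some finitely generated model `R'` of the COVER field
`L = K(θ)`, `θ ^ p = g₀`, inside a valuation ring `OL` of `L` lying over `O`, containing the image of `A` and `θ`, is regular
of dimension 3 at the centre with a regular system of parameters `(r₁, r₂, r₃)` of which `r₁, r₂` come from `K`, then the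
`K^p`-line of `g₀` has a loosely clean representative (form (3): `r₃ ^ p` on `R' ∩ K`).  Ingredients: Kunz (flatness of
Frobenius on a regular ring), `Literature.RingTheory.PBasis.KunzConjectureReduction.{free, isRegularLocalRing_adjoinRoot_of_not_mem_sq}`.
Unproved here (size M). [folklore] -/
def KRatSandwichAt (p : ℕ) : Prop :=
    ∀ (k : Type) [Field k] [CharP k p] [PerfectField k] (K : Type) [Field K] [Algebra k K]
    (O : ValuationSubring K) (A : Subalgebra k K), A.toSubring ≤ O.toSubring → A.FG → IsFractionRing A K →
    ∀ (g₀ : K), (∀ c : K, c ^ p ≠ g₀) →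
    ∀ (L : Type) [Field L] [Algebra K L] [Algebra k L] [IsScalarTower k K L] (θ : L),
      θ ^ p = algebraMap K L g₀ → Module.finrank K L = p →
    ∀ (OL : ValuationSubring L), (∀ x : K, algebraMap K L x ∈ OL ↔ x ∈ O) →
    ∀ (R' : Subalgebra k L), R'.toSubring ≤ OL.toSubring → R'.FG → θ ∈ R' →
      (∀ a ∈ A, algebraMap K L a ∈ R') →
    ∀ (_ : IsRegularLocalRing (locAtCentre R'.toSubring OL))
      (r₁ r₂ r₃ : ↥(locAtCentre R'.toSubring OL)),
      Ideal.span {r₁, r₂, r₃} = IsLocalRing.maximalIdeal ↥(locAtCentre R'.toSubring OL) →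
      ringKrullDim ↥(locAtCentre R'.toSubring OL) = 3 →
      (r₁ : L) ∈ Set.range (algebraMap K L) → (r₂ : L) ∈ Set.range (algebraMap K L) →
      CleanLUConcl p k K O A g₀

end OddP

end Summit.ResolutionOfSingularities.ResolutionOfSingularities.Cruxes.DescentPerfectToAll.CpSibling.BaseSide

end
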